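import Mathlib.NumberTheory.Padics.RingHoms
import Mathlib.Tactic.NormNum.Prime
import Mathlib.Topology.Algebra.Valued.NormedValued
import Literature.NumberTheory.EllipticCurves.KubertTwoTwelveProofs
import Literature.NumberTheory.EllipticCurves.Curve21A1Descent
import HarnessLib

/-!
# The eight rational points of `21a1 = X₀(21)` (Cremona, Table 1, `N = 21`, curve `A1`:
# `r = 0`, `|T| = 8`) — unconditionally

`Proofs` file (theorems only: **no definition, no named fact, nothing asserted**) completing the
tree's `Curve21A1Descent.lean` (`Literature.NumberTheory.EllipticCurves.Curve21A1.finite_point`: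
the Mordell–Weil group of Cremona's `21a1 : y² + xy = x³ − 4x − 1`, `[1, 0, 0, -4, -1]`,
`Δ = 3969 = 3⁴·7²`, is FINITE, by a complete `2`-descent) to the LIST of its rational points:

* `Curve21A1.natCard_point_eq_eight` — `#E(ℚ) = 8`;
* `Curve21A1.mem_points_of_equation` — every rational solution of `y² + xy = x³ − 4x − 1` is one
  of `(−2, 1), (−1, −1), (−1, 2), (−1/4, 1/8), (2, −1), (5, −13), (5, 8)` (with `O`: the eight
  points, `E(ℚ) ≅ ℤ/4 × ℤ/2`).

These are the rational points of the modular curve `X₀(21) ≅ 21a1` (Ligozat 1975; the explicit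
isomorphism is the tree's `XZeroTwentyOneExplicit`): four cusps and the four curves `162b1–4`
with a rational cyclic `21`-isogeny (Kenku 1982). Consumer: the `n = 21` leaf of Mazur's First
reduction (`KubertTwentyOneProofs.lean`: no rational point of order `21`).

PROVENANCE. The argument (and most of the Lean text) is the one of the Summits-side stub
`Summit.ABC.ABC.Theorems.stub_twentyonePoints`
(`Summits/ABC/ABC/Theorems/IsogenyGlueCongruenceMazurKenkuBoundStubTwentyonePoints.lean`, crux
`MazurKenkuBound`, which takes the finiteness as a hypothesis), itself modelled on the tree's
`KubertTwoTwelveProofs.lean` (curve `24A1`, primes `5, 7`); it is RE-HOMED here to `Literature/`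
(known mathematics: a line of Cremona's table), where a `Literature/` consumer can import it, and
made unconditional with `Curve21A1.finite_point`.

## The proof

1. `21a1` has good reduction at `5` and `11` (`Δ = 3969 = 3⁴·7²`) with `#Ẽ(𝔽₅) = #Ẽ(𝔽₁₁) = 8`
   (enumeration of the affine solutions, `decide`).
2. The prime-to-`ℓ` torsion of `E(ℚ)` injects into `Ẽ(𝔽_ℓ)` at a good prime `ℓ` (Silverman,
   *AEC*, Prop. VII.3.1(b); the tree's `injective_reduceHom`, `PointReduction.lean`, for the
   `ℓ`-adic absolute value of `ℚ` and the residue map `ℤ_(ℓ) → ℤ_ℓ → 𝔽_ℓ`). For `P ∈ E(ℚ)` of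
   finite order `n = 5ᵃm`, `5 ∤ m`, the point `mP` is killed by `5ᵃ`, hence lies in the
   prime-to-`11` torsion, hence is killed by `#Ẽ(𝔽₁₁) = 8`; so `8mP = 0` and `P` lies in the
   prime-to-`5` torsion: the (finite) group `E(ℚ)` injects into `Ẽ(𝔽₅)`, `#E(ℚ) ≤ 8`.
3. `O` and the seven listed pairs are eight distinct rational points, so they exhaust `E(ℚ)`.

## References

* [CremonaAlgorithms1997] J. E. Cremona, *Algorithms for Modular Elliptic Curves*, 2nd ed., CUP
  1997: Table 1, `N = 21`, curve `A1 = [1, 0, 0, -4, -1]`, `r = 0`, `|T| = 8`; §3.3.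
* [SilvermanAEC2009] J. H. Silverman, *The Arithmetic of Elliptic Curves*, 2nd ed., GTM 106:
  Prop. VII.3.1 (torsion injects into the reduction), VII.§2.
* [Ligozat1975] G. Ligozat, *Courbes modulaires de genre 1*, Mém. SMF 43 (1975) (`X₀(21)`).
* [Kenku1982] M. A. Kenku, J. Number Theory 15 (1982) 199–202, proof of Thm. 1 (level `21`).

## Design

* Theorems only; the curve is written literally as `(⟨1, 0, 0, -4, -1⟩ : WeierstrassCurve ℚ)`
  (the term of `Curve21A1Descent.finite_point`) and its reduction as
  `(⟨1, 0, 0, -4, -1⟩ : WeierstrassCurve (ZMod ℓ))`; the `ℓ`-adic absolute value of `ℚ` is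
  `(NormedField.valuation.comap (Rat.castHom ℚ_[ℓ]) : Valuation ℚ ℝ≥0)` as in the template, whose
  local lemmas `Curve24A1.intCast_mem_integer`, `Curve24A1.valuation_natCast_eq_one` are reused.
* Namespace `Literature.NumberTheory.EllipticCurves.Curve21A1` (the story of
  `Curve21A1Descent.lean`); helper lemmas `private`. The group law on points is elaborated against
  the classical `DecidableEq` instances (`letI := Classical.decEq _`, those of
  `PointReduction.lean`); the two exported statements do not mention the group law.
  Axioms: `propext`, `Classical.choice`, `Quot.sound`.
-/

noncomputable section

open scoped NNReal
open WeierstrassCurve WeierstrassCurve.Affine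

namespace Literature.NumberTheory.EllipticCurves

namespace Curve21A1

/-! ### `21a1`, its reduction modulo `ℓ`, and its points over `𝔽₅` and `𝔽₁₁` -/

/-- `Δ(21a1) = 3969 = 3⁴·7²`, so `21a1` is an elliptic curve over `ℚ` (Cremona, Table 1,
`N = 21`, `A1 = [1, 0, 0, -4, -1]`). [cite: CremonaAlgorithms1997, Table 1, N = 21, curve A1] -/
theorem Δ_eq_and_isElliptic : (⟨1, 0, 0, -4, -1⟩ : WeierstrassCurve ℚ).Δ = 3969 ∧
    (⟨1, 0, 0, -4, -1⟩ : WeierstrassCurve ℚ).IsElliptic := by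
  have hΔ : (⟨1, 0, 0, -4, -1⟩ : WeierstrassCurve ℚ).Δ = 3969 := by
    norm_num [WeierstrassCurve.Δ, b₂, b₄, b₆, b₈]
  exact ⟨hΔ, ⟨by rw [hΔ]; norm_num⟩⟩

/-- The affine equation of `21a1` is `y² + xy = x³ - 4x - 1`.
[cite: CremonaAlgorithms1997, Table 1, N = 21, curve A1] -/
private theorem equation_iff' (x y : ℚ) :
    (⟨1, 0, 0, -4, -1⟩ : WeierstrassCurve ℚ).toAffine.Equation x y ↔
      y ^ 2 + x * y = x ^ 3 - 4 * x - 1 := by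
  rw [Affine.equation_iff]
  constructor <;> intro h <;> linear_combination h

/-- `Δ = 3969` for the reduction `[1, 0, 0, -4, -1]` of `21a1` modulo `ℓ` (the same integral
equation read over `ZMod ℓ`). [cite: CremonaAlgorithms1997, Table 1, N = 21, curve A1] -/
private theorem reduction_Δ' (ℓ : ℕ) : (⟨1, 0, 0, -4, -1⟩ : WeierstrassCurve (ZMod ℓ)).Δ = 3969 := by
  norm_num [WeierstrassCurve.Δ, b₂, b₄, b₆, b₈]

/-- The affine equation of `21a1` modulo `ℓ`: `y² + xy = x³ - 4x - 1`.
[cite: CremonaAlgorithms1997, Table 1, N = 21, curve A1] -/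
private theorem equation_reduction_iff' (ℓ : ℕ) (x y : ZMod ℓ) :
    (⟨1, 0, 0, -4, -1⟩ : WeierstrassCurve (ZMod ℓ)).toAffine.Equation x y ↔
      y ^ 2 + x * y = x ^ 3 - 4 * x - 1 := by
  rw [Affine.equation_iff]
  constructor <;> intro h <;> linear_combination h

/-- `y² + xy = x³ - 4x - 1` has exactly `7` affine solutions over `𝔽₅` and over `𝔽₁₁`, by
enumeration. [folklore] -/
private theorem card_solutions_five_eleven :
    Fintype.card {xy : ZMod 5 × ZMod 5 // xy.2 ^ 2 + xy.1 * xy.2 = xy.1 ^ 3 - 4 * xy.1 - 1} = 7 ∧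
    Fintype.card {xy : ZMod 11 × ZMod 11 // xy.2 ^ 2 + xy.1 * xy.2 = xy.1 ^ 3 - 4 * xy.1 - 1} =
      7 := by
  constructor <;> decide

/-- **`#Ẽ(𝔽_ℓ) = 8` for `ℓ ∈ {5, 11}`**, `E = 21a1` (`7` affine points and `O`; equivalently
`a₅ = -2`, `a₁₁ = 4`, Cremona Table 1/3, `21A1`): the point count of the reduced equation
`[1, 0, 0, -4, -1]` over `ZMod ℓ` from the number of affine solutions.
[cite: CremonaAlgorithms1997, Table 1, N = 21, curve A1] -/
private theorem natCard_point_reduction (ℓ : ℕ) [Fact ℓ.Prime] (hℓ : (3969 : ZMod ℓ) ≠ 0)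
    (h7 : Fintype.card {xy : ZMod ℓ × ZMod ℓ //
      xy.2 ^ 2 + xy.1 * xy.2 = xy.1 ^ 3 - 4 * xy.1 - 1} = 7) :
    Nat.card (⟨1, 0, 0, -4, -1⟩ : WeierstrassCurve (ZMod ℓ)).toAffine.Point = 8 := by
  haveI : (⟨1, 0, 0, -4, -1⟩ : WeierstrassCurve (ZMod ℓ)).IsElliptic :=
    ⟨by rw [reduction_Δ']; exact isUnit_iff_ne_zero.mpr hℓ⟩
  have e : {xy : ZMod ℓ × ZMod ℓ //
      (⟨1, 0, 0, -4, -1⟩ : WeierstrassCurve (ZMod ℓ)).toAffine.Equation xy.1 xy.2} ≃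
      {xy : ZMod ℓ × ZMod ℓ // xy.2 ^ 2 + xy.1 * xy.2 = xy.1 ^ 3 - 4 * xy.1 - 1} :=
    Equiv.subtypeEquivRight fun xy => equation_reduction_iff' ℓ xy.1 xy.2
  rw [Nat.card_congr (WeierstrassCurve.Affine.pointEquiv
    (⟨1, 0, 0, -4, -1⟩ : WeierstrassCurve (ZMod ℓ)).toAffine)]
  change Nat.card (Option _) = 8
  rw [Finite.card_option, Nat.card_congr e, Nat.card_eq_fintype_card, h7]

/-! ### Integrality, good reduction and the reduction map at a prime `ℓ ∤ 3969` -/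

section Local

variable (ℓ : ℕ) [Fact ℓ.Prime]

/-- **The prime-to-`ℓ` torsion of `21a1(ℚ)` injects into `Ẽ(𝔽_ℓ)`** at a prime `ℓ` of good
reduction, `ℓ ∤ 3969` (Silverman, *AEC*, Prop. VII.3.1(b) with Prop. VII.2.1; here the tree's
`reduceHom` / `injective_reduceHom` of `PointReduction.lean` for the `ℓ`-adic absolute value of
`ℚ`, the residue map `ℤ_(ℓ) → ℤ_ℓ → 𝔽_ℓ` — Mathlib's `PadicInt.toZMod`, kernel `{‖q‖_ℓ < 1}`
(`PadicInt.ker_toZMod`) — and the reduced equation `[1, 0, 0, -4, -1]` over `𝔽_ℓ`; `21a1` is an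
`ℓ`-integral equation and `‖Δ‖_ℓ = ‖3969‖_ℓ = 1`). The group laws are elaborated against the
classical `DecidableEq` instances. [cite: SilvermanAEC2009, Prop. VII.3.1(b)] -/
private theorem exists_reduceHom' (h : IsCoprime (3969 : ℤ) ℓ) :
    letI := Classical.decEq ℚ
    letI := Classical.decEq (ZMod ℓ)
    ∃ f : goodTorsion (NormedField.valuation.comap (Rat.castHom ℚ_[ℓ]) : Valuation ℚ ℝ≥0)
        (⟨1, 0, 0, -4, -1⟩ : WeierstrassCurve ℚ) →+
          (⟨1, 0, 0, -4, -1⟩ : WeierstrassCurve (ZMod ℓ)).toAffine.Point,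
      Function.Injective f := by
  letI := Classical.decEq ℚ
  letI := Classical.decEq (ZMod ℓ)
  set w : Valuation ℚ ℝ≥0 := NormedField.valuation.comap (Rat.castHom ℚ_[ℓ]) with hw
  have hw1 : ∀ q : ℚ, w q ≤ 1 ↔ ‖(q : ℚ_[ℓ])‖ ≤ 1 := fun q => by
    rw [hw, Valuation.comap_apply, ← NNReal.coe_le_coe, NNReal.coe_one]; rfl
  have hw1' : ∀ q : ℚ, w q < 1 ↔ ‖(q : ℚ_[ℓ])‖ < 1 := fun q => by
    rw [hw, Valuation.comap_apply, ← NNReal.coe_lt_coe, NNReal.coe_one]; rfl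
  -- `21a1` is an `ℓ`-integral equation
  haveI : (⟨1, 0, 0, -4, -1⟩ : WeierstrassCurve ℚ).IsIntegral w.integer :=
    ⟨⟨⟨1, Curve24A1.intCast_mem_integer ℓ 1⟩, ⟨0, Curve24A1.intCast_mem_integer ℓ 0⟩,
      ⟨0, Curve24A1.intCast_mem_integer ℓ 0⟩, ⟨-4, Curve24A1.intCast_mem_integer ℓ (-4)⟩,
      ⟨-1, Curve24A1.intCast_mem_integer ℓ (-1)⟩⟩, rfl⟩
  -- the residue map `ℤ_(ℓ) → ℤ_ℓ → 𝔽_ℓ`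
  let ι : w.integer →+* ℤ_[ℓ] :=
    { toFun := fun a => ⟨((a : ℚ) : ℚ_[ℓ]), (hw1 a).mp a.2⟩
      map_one' := Subtype.ext (by simp)
      map_mul' := fun a b => Subtype.ext (by simp)
      map_zero' := Subtype.ext (by simp)
      map_add' := fun a b => Subtype.ext (by simp) }
  let r : w.integer →+* ZMod ℓ := PadicInt.toZMod.comp ι
  have hr : ∀ a : w.integer, r a = 0 ↔ w (a : ℚ) < 1 := fun a => by
    rw [hw1', RingHom.comp_apply, ← RingHom.mem_ker, PadicInt.ker_toZMod,
      IsLocalRing.mem_maximalIdeal, PadicInt.mem_nonunits, PadicInt.norm_def]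
    rfl
  -- good reduction: `‖Δ‖_ℓ = ‖3969‖_ℓ = 1`
  have hΔ : w (⟨1, 0, 0, -4, -1⟩ : WeierstrassCurve ℚ).Δ = 1 := by
    rw [Δ_eq_and_isElliptic.1, hw, Valuation.comap_apply, ← NNReal.coe_eq_one]
    change ‖((3969 : ℚ) : ℚ_[ℓ])‖ = 1
    rw [show ((3969 : ℚ) : ℚ_[ℓ]) = ((3969 : ℤ) : ℚ_[ℓ]) by norm_cast]
    exact Padic.norm_intCast_eq_one_iff.mpr h
  -- the reduced equation
  have hred : reduceCurve r (⟨1, 0, 0, -4, -1⟩ : WeierstrassCurve ℚ) =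
      (⟨1, 0, 0, -4, -1⟩ : WeierstrassCurve (ZMod ℓ)) := by
    ext
    · show reduceFun r (1 : ℚ) = 1
      rw [show (1 : ℚ) = ((1 : ℤ) : ℚ) by norm_num, reduceFun_intCast]; norm_num
    · show reduceFun r (0 : ℚ) = 0
      rw [show (0 : ℚ) = ((0 : ℤ) : ℚ) by norm_num, reduceFun_intCast]; norm_num
    · show reduceFun r (0 : ℚ) = 0
      rw [show (0 : ℚ) = ((0 : ℤ) : ℚ) by norm_num, reduceFun_intCast]; norm_num
    · show reduceFun r (-4 : ℚ) = -4
      rw [show (-4 : ℚ) = ((-4 : ℤ) : ℚ) by norm_num, reduceFun_intCast]; norm_num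
    · show reduceFun r (-1 : ℚ) = -1
      rw [show (-1 : ℚ) = ((-1 : ℤ) : ℚ) by norm_num, reduceFun_intCast]; norm_num
  exact ⟨reduceHom w r hr hΔ hred, injective_reduceHom hr hΔ hred⟩

end Local

/-! ### `#E(ℚ) = 8` by reduction modulo `5` and `11` -/

/-- **`#21a1(ℚ) = 8`** (Cremona's Table 1 entry `21A1: r = 0, |T| = 8`). Upper bound as in
Cremona §3.3 / Silverman, *AEC*, VII.3.1, by reducing the FINITE group `E(ℚ)`
(`Curve21A1.finite_point`) modulo good primes: every `P ∈ E(ℚ)` has an order `n = 5ᵃ m`,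
`5 ∤ m`; then `mP` is killed by `5ᵃ`, lies in the prime-to-`11` torsion, which injects into
`Ẽ(𝔽₁₁)` of order `8`, so `8mP = 0` and `P` lies in the prime-to-`5` torsion; the latter injects
into `Ẽ(𝔽₅)` of order `8`. Lower bound: `O` and the seven affine points
`(−2, 1), (−1, −1), (−1, 2), (−1/4, 1/8), (2, −1), (5, −13), (5, 8)` are eight distinct points.
[cite: CremonaAlgorithms1997, Table 1, N = 21, curve A1 (r = 0, |T| = 8)]
[cite: SilvermanAEC2009, Prop. VII.3.1] -/
theorem natCard_point_eq_eight :
    Nat.card (⟨1, 0, 0, -4, -1⟩ : WeierstrassCurve ℚ).toAffine.Point = 8 := by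
  have h3969₅ : (3969 : ZMod 5) ≠ 0 := by decide
  have h3969₁₁ : (3969 : ZMod 11) ≠ 0 := by decide
  haveI : Fact (Nat.Prime 5) := ⟨by norm_num⟩
  haveI : Fact (Nat.Prime 11) := ⟨by norm_num⟩
  have h5 : Nat.card (⟨1, 0, 0, -4, -1⟩ : WeierstrassCurve (ZMod 5)).toAffine.Point = 8 :=
    natCard_point_reduction 5 h3969₅ card_solutions_five_eleven.1
  have h11 : Nat.card (⟨1, 0, 0, -4, -1⟩ : WeierstrassCurve (ZMod 11)).toAffine.Point = 8 :=
    natCard_point_reduction 11 h3969₁₁ card_solutions_five_eleven.2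
  letI := Classical.decEq ℚ
  letI : DecidableEq (ZMod 5) := Classical.decEq _
  letI : DecidableEq (ZMod 11) := Classical.decEq _
  haveI : (⟨1, 0, 0, -4, -1⟩ : WeierstrassCurve ℚ).IsElliptic := Δ_eq_and_isElliptic.2
  haveI : Finite (⟨1, 0, 0, -4, -1⟩ : WeierstrassCurve ℚ).toAffine.Point := finite_point
  obtain ⟨f₅, hf₅⟩ := exists_reduceHom' 5 (by norm_num [Int.isCoprime_iff_gcd_eq_one])
  obtain ⟨f₁₁, hf₁₁⟩ := exists_reduceHom' 11 (by norm_num [Int.isCoprime_iff_gcd_eq_one])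
  haveI : Finite (⟨1, 0, 0, -4, -1⟩ : WeierstrassCurve (ZMod 5)).toAffine.Point :=
    Nat.finite_of_card_ne_zero (by rw [h5]; norm_num)
  refine le_antisymm ?_ ?_
  · -- every rational point lies in the prime-to-`5` torsion
    have hgood : ∀ P : (⟨1, 0, 0, -4, -1⟩ : WeierstrassCurve ℚ).toAffine.Point, P ∈ goodTorsion
        (NormedField.valuation.comap (Rat.castHom ℚ_[5]) : Valuation ℚ ℝ≥0)
        (⟨1, 0, 0, -4, -1⟩ : WeierstrassCurve ℚ) := by
      intro P
      obtain ⟨n, hn, hnP⟩ := isOfFinAddOrder_iff_nsmul_eq_zero.mp (isOfFinAddOrder_of_finite P)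
      obtain ⟨a, m, hm, rfl⟩ := Nat.exists_eq_pow_mul_and_not_dvd hn.ne' 5 (by norm_num)
      -- `m • P` is killed by `5 ^ a`, hence lies in the prime-to-`11` torsion
      have hR : m • P ∈ goodTorsion
          (NormedField.valuation.comap (Rat.castHom ℚ_[11]) : Valuation ℚ ℝ≥0)
          (⟨1, 0, 0, -4, -1⟩ : WeierstrassCurve ℚ) := by
        refine mem_goodTorsion_of_zsmul_eq_zero (n := ((5 ^ a : ℕ) : ℤ)) ?_ ?_
        · rw [Int.cast_natCast]
          exact Curve24A1.valuation_natCast_eq_one 11 (Nat.Coprime.pow_right a (by norm_num))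
        · rw [natCast_zsmul, ← mul_nsmul', hnP]
      -- hence is killed by `#Ẽ(𝔽₁₁) = 8`
      have h8 : 8 • (m • P) = 0 := by
        have key : (8 : ℕ) • (⟨m • P, hR⟩ : goodTorsion
            (NormedField.valuation.comap (Rat.castHom ℚ_[11]) : Valuation ℚ ℝ≥0)
            (⟨1, 0, 0, -4, -1⟩ : WeierstrassCurve ℚ)) = 0 := by
          apply hf₁₁
          rw [map_nsmul, map_zero, ← h11]
          exact card_nsmul_eq_zero'
        have key' := congrArg Subtype.val key
        simpa using key'
      refine mem_goodTorsion_of_zsmul_eq_zero (n := ((8 * m : ℕ) : ℤ)) ?_ ?_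
      · rw [Int.cast_natCast]
        refine Curve24A1.valuation_natCast_eq_one 5 (Nat.Coprime.mul_right (by norm_num) ?_)
        exact (Nat.Prime.coprime_iff_not_dvd (by norm_num)).mpr hm
      · rw [natCast_zsmul, mul_nsmul', h8]
    -- so `E(ℚ)` injects into `Ẽ(𝔽₅)`
    have hinj : Function.Injective
        fun P : (⟨1, 0, 0, -4, -1⟩ : WeierstrassCurve ℚ).toAffine.Point => f₅ ⟨P, hgood P⟩ := by
      intro P Q hPQ
      have := hf₅ hPQ
      simpa using this
    calc Nat.card (⟨1, 0, 0, -4, -1⟩ : WeierstrassCurve ℚ).toAffine.Point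
        ≤ Nat.card (⟨1, 0, 0, -4, -1⟩ : WeierstrassCurve (ZMod 5)).toAffine.Point :=
          Nat.card_le_card_of_injective _ hinj
      _ = 8 := h5
  · -- eight distinct rational points, by coordinates
    letI : Fintype (⟨1, 0, 0, -4, -1⟩ : WeierstrassCurve ℚ).toAffine.Point := Fintype.ofFinite _
    have hns : ∀ {a b : ℚ}, (⟨1, 0, 0, -4, -1⟩ : WeierstrassCurve ℚ).toAffine.Equation a b →
        (⟨1, 0, 0, -4, -1⟩ : WeierstrassCurve ℚ).toAffine.Nonsingular a b :=
      fun hab => equation_iff_nonsingular.mp hab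
    let φ : (⟨1, 0, 0, -4, -1⟩ : WeierstrassCurve ℚ).toAffine.Point → Option (ℚ × ℚ) :=
      fun P => match P with
      | .zero => none
      | .some a b _ => some (a, b)
    let T : Finset (Option (ℚ × ℚ)) :=
      {none, some (-2, 1), some (-1, -1), some (-1, 2), some (-1 / 4, 1 / 8), some (2, -1),
        some (5, -13), some (5, 8)}
    have hT : T.card = 8 := by
      simp only [T]
      rw [Finset.card_insert_of_notMem (by simp), Finset.card_insert_of_notMem (by norm_num),
        Finset.card_insert_of_notMem (by norm_num), Finset.card_insert_of_notMem (by norm_num),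
        Finset.card_insert_of_notMem (by norm_num), Finset.card_insert_of_notMem (by norm_num),
        Finset.card_insert_of_notMem (by norm_num), Finset.card_singleton]
    have hpt : ∀ {a b : ℚ}, (⟨1, 0, 0, -4, -1⟩ : WeierstrassCurve ℚ).toAffine.Equation a b →
        some (a, b) ∈ Finset.univ.image φ :=
      fun {a b} hab => Finset.mem_image.mpr ⟨.some a b (hns hab), Finset.mem_univ _, rfl⟩
    have hTsub : T ⊆ Finset.univ.image φ := by
      intro t ht
      simp only [T, Finset.mem_insert, Finset.mem_singleton] at ht
      rcases ht with rfl | rfl | rfl | rfl | rfl | rfl | rfl | rfl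
      · exact Finset.mem_image.mpr ⟨0, Finset.mem_univ _, rfl⟩
      all_goals exact hpt ((equation_iff' _ _).mpr (by norm_num))
    calc 8 = T.card := hT.symm
      _ ≤ (Finset.univ.image φ).card := Finset.card_le_card hTsub
      _ ≤ (Finset.univ : Finset (⟨1, 0, 0, -4, -1⟩ : WeierstrassCurve ℚ).toAffine.Point).card :=
          Finset.card_image_le
      _ = Nat.card (⟨1, 0, 0, -4, -1⟩ : WeierstrassCurve ℚ).toAffine.Point := by
          rw [Finset.card_univ, Nat.card_eq_fintype_card]

/-- **The rational points of `21a1`** (Cremona, *Algorithms for Modular Elliptic Curves*, Table 1,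
`N = 21`, curve `A1 = [1, 0, 0, -4, -1]`: `r = 0`, `|T| = 8`): every rational solution of
`y² + xy = x³ - 4x - 1` is one of `(-2, 1), (-1, -1), (-1, 2), (-1/4, 1/8), (2, -1), (5, -13),
(5, 8)`. Proof: these seven pairs and `O` give eight distinct points of `E(ℚ)`, and `#E(ℚ) = 8`
(`natCard_point_eq_eight`), so they exhaust `E(ℚ)` (counted through the injection
`P ↦ (x(P), y(P))` into `Option (ℚ × ℚ)`). These are the eight rational points of
`X₀(21) ≅ 21a1` — four cusps and the four non-cuspidal points (Ligozat 1975; Kenku 1982, level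
`21`). [cite: CremonaAlgorithms1997, Table 1, N = 21, curve A1 (r = 0, |T| = 8)]
[cite: Ligozat1975] -/
theorem mem_points_of_equation (x y : ℚ) (hxy : y ^ 2 + x * y = x ^ 3 - 4 * x - 1) :
    (x, y) ∈ ({(-2, 1), (-1, -1), (-1, 2), (-1 / 4, 1 / 8), (2, -1), (5, -13), (5, 8)} :
      Finset (ℚ × ℚ)) := by
  haveI : (⟨1, 0, 0, -4, -1⟩ : WeierstrassCurve ℚ).IsElliptic := Δ_eq_and_isElliptic.2
  haveI : Finite (⟨1, 0, 0, -4, -1⟩ : WeierstrassCurve ℚ).toAffine.Point := finite_point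
  letI : Fintype (⟨1, 0, 0, -4, -1⟩ : WeierstrassCurve ℚ).toAffine.Point := Fintype.ofFinite _
  have hns : ∀ {a b : ℚ}, (⟨1, 0, 0, -4, -1⟩ : WeierstrassCurve ℚ).toAffine.Equation a b →
      (⟨1, 0, 0, -4, -1⟩ : WeierstrassCurve ℚ).toAffine.Nonsingular a b :=
    fun hab => equation_iff_nonsingular.mp hab
  -- coordinates
  let φ : (⟨1, 0, 0, -4, -1⟩ : WeierstrassCurve ℚ).toAffine.Point → Option (ℚ × ℚ) :=
    fun P => match P with
    | .zero => none
    | .some a b _ => some (a, b)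
  -- the eight known points, by coordinates
  let T : Finset (Option (ℚ × ℚ)) :=
    {none, some (-2, 1), some (-1, -1), some (-1, 2), some (-1 / 4, 1 / 8), some (2, -1),
      some (5, -13), some (5, 8)}
  have hT : T.card = 8 := by
    simp only [T]
    rw [Finset.card_insert_of_notMem (by simp), Finset.card_insert_of_notMem (by norm_num),
      Finset.card_insert_of_notMem (by norm_num), Finset.card_insert_of_notMem (by norm_num),
      Finset.card_insert_of_notMem (by norm_num), Finset.card_insert_of_notMem (by norm_num),
      Finset.card_insert_of_notMem (by norm_num), Finset.card_singleton]
  have hpt : ∀ {a b : ℚ}, (⟨1, 0, 0, -4, -1⟩ : WeierstrassCurve ℚ).toAffine.Equation a b →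
      some (a, b) ∈ Finset.univ.image φ :=
    fun {a b} hab => Finset.mem_image.mpr ⟨.some a b (hns hab), Finset.mem_univ _, rfl⟩
  have hTsub : T ⊆ Finset.univ.image φ := by
    intro t ht
    simp only [T, Finset.mem_insert, Finset.mem_singleton] at ht
    rcases ht with rfl | rfl | rfl | rfl | rfl | rfl | rfl | rfl
    · exact Finset.mem_image.mpr ⟨0, Finset.mem_univ _, rfl⟩
    all_goals exact hpt ((equation_iff' _ _).mpr (by norm_num))
  have hcard : (Finset.univ.image φ).card ≤ T.card := by
    rw [hT]
    calc (Finset.univ.image φ).card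
        ≤ (Finset.univ : Finset (⟨1, 0, 0, -4, -1⟩ : WeierstrassCurve ℚ).toAffine.Point).card :=
          Finset.card_image_le
      _ = Nat.card (⟨1, 0, 0, -4, -1⟩ : WeierstrassCurve ℚ).toAffine.Point := by
          rw [Finset.card_univ, Nat.card_eq_fintype_card]
      _ ≤ 8 := natCard_point_eq_eight.le
  have heq : T = Finset.univ.image φ := Finset.eq_of_subset_of_card_le hTsub hcard
  have hxy' : (⟨1, 0, 0, -4, -1⟩ : WeierstrassCurve ℚ).toAffine.Equation x y :=
    (equation_iff' x y).mpr hxy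
  have hmem : φ (.some x y (hns hxy')) ∈ T := by
    rw [heq]
    exact Finset.mem_image_of_mem φ (Finset.mem_univ (Affine.Point.some x y (hns hxy')))
  simp only [T, φ, Finset.mem_insert, Finset.mem_singleton, Option.some.injEq, reduceCtorEq,
    false_or] at hmem
  simp only [Finset.mem_insert, Finset.mem_singleton]
  exact hmem

/-- **The rational points of `21a1`, as points**: every `P ∈ E(ℚ)` is `O` or one of the seven
affine points listed in `mem_points_of_equation`.
[cite: CremonaAlgorithms1997, Table 1, N = 21, curve A1 (r = 0, |T| = 8)] -/
theorem point_cases (P : (⟨1, 0, 0, -4, -1⟩ : WeierstrassCurve ℚ).toAffine.Point) :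
    P = 0 ∨ ∃ x y h, P = Affine.Point.some x y h ∧
      (x, y) ∈ ({(-2, 1), (-1, -1), (-1, 2), (-1 / 4, 1 / 8), (2, -1), (5, -13), (5, 8)} :
        Finset (ℚ × ℚ)) := by
  rcases P with _ | ⟨x, y, h⟩
  · exact Or.inl rfl
  · exact Or.inr ⟨x, y, h, rfl, mem_points_of_equation x y ((equation_iff' x y).mp h.1)⟩

end Curve21A1

end Literature.NumberTheory.EllipticCurves

end
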